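import Summits.QuantumFields.YangMills.Theorems.ConvexGribovBodyNonSimplyConnectedLatticeGapDefs
import HarnessLib

/-!
# Crux `NonSimplyConnectedLatticeGap` (stmt-QuantumFields-16405), route `ConvexGribovBody`,
# line `Sketch` (v12) — stub `stub_chainCount` (COUNT: the Peierls entropy factor)

Pure combinatorics: the chains `c 0, …, c k` of plaquettes of `ℤ⁴` starting at a fixed plaquette
`p₀` whose consecutive base points are within `ℓ∞`-distance `2` form a finite set of cardinality at
most `3750 ^ k = (5⁴ · 6) ^ k`.

Proof: a chain is determined by its start and its STEP DATA `i ↦ (x_i − x_{i+1}, orientation of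
c (i+1))` (injective on the chain set, by induction along `Fin (k+1)`), and the step data of an
admissible chain lie in the finset `([-2,2]⁴ × orientations)^k`, of cardinality
`(625 · 6) ^ k = 3750 ^ k`.
-/

set_option autoImplicit false

noncomputable section

namespace Summit.QuantumFields.YangMills.Theorems.NonSimplyConnectedLatticeGap

open Literature.Probability.LatticeModels
open Literature.MathematicalPhysics.QuantumLattice
open Summit.QuantumFields.YangMills.Cruxes.NonSimplyConnectedLatticeGap.Sketch (siteSupNorm)

/-- A displacement of sup-norm `≤ 2` lies in the box `[-2,2]⁴`. -/
theorem chainCount_mem_box {x : Site 4} (h : siteSupNorm x ≤ 2) :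
    x ∈ Fintype.piFinset fun _ : Fin 4 => Finset.Icc (-2 : ℤ) 2 := by
  rw [Fintype.mem_piFinset]
  intro a
  have ha : (x a).natAbs ≤ 2 := (Finset.sup_le_iff.1 h) a (Finset.mem_univ a)
  rw [Finset.mem_Icc]
  omega

/-- `#[-2,2]⁴ = 625`. -/
theorem chainCount_card_box :
    (Fintype.piFinset fun _ : Fin 4 => Finset.Icc (-2 : ℤ) 2).card = 625 := by
  rw [Fintype.card_piFinset, Finset.prod_const, Finset.card_univ, Fintype.card_fin, Int.card_Icc]
  rfl

/-- There are `6` plaquette orientations `i < j` in `ℤ⁴`. -/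
theorem chainCount_card_orient :
    (Finset.univ : Finset {p : Fin 4 × Fin 4 // p.1 < p.2}).card = 6 := by
  rfl

/-- Two chains with the same start and the same step data (`i`-th base-point displacement
`x_i − x_{i+1}` and orientation of `c (i+1)`) coincide. -/
theorem chainCount_steps_injOn (k : ℕ) (p₀ : ZdPlaquette 4) :
    Set.InjOn (fun (c : Fin (k + 1) → ZdPlaquette 4) (i : Fin k) =>
        ((c i.castSucc).1 - (c i.succ).1, (c i.succ).2))
      {c : Fin (k + 1) → ZdPlaquette 4 | c 0 = p₀} := by
  intro c hc c' hc' h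
  funext i
  induction i using Fin.induction with
  | zero => exact hc.trans hc'.symm
  | succ i ih =>
    have hi := congrFun h i
    simp only [Prod.mk.injEq] at hi
    obtain ⟨h1, h2⟩ := hi
    rw [ih] at h1
    exact Prod.ext (sub_right_injective h1) h2

/-- **Registered stub COUNT — the Peierls entropy factor**: the chains of `k + 1` plaquettes of `ℤ⁴`
from a fixed start `p₀` with consecutive base points within `ℓ∞`-distance `2` form a finite set of
cardinality at most `3750 ^ k` (`3750 = 5⁴ · 6`: displacements in `[-2,2]⁴` times orientations).
[folklore] -/
theorem stub_chainCount : ∀ (k : ℕ) (p₀ : Literature.MathematicalPhysics.QuantumLattice.ZdPlaquette 4), ({c : Fin (k + 1) → Literature.MathematicalPhysics.QuantumLattice.ZdPlaquette 4 | c 0 = p₀ ∧ ∀ i : Fin k, Summit.QuantumFields.YangMills.Cruxes.NonSimplyConnectedLatticeGap.Sketch.siteSupNorm ((c i.castSucc).1 - (c i.succ).1) ≤ 2}).Finite ∧ ({c : Fin (k + 1) → Literature.MathematicalPhysics.QuantumLattice.ZdPlaquette 4 | c 0 = p₀ ∧ ∀ i : Fin k, Summit.QuantumFields.YangMills.Cruxes.NonSimplyConnectedLatticeGap.Sketch.siteSupNorm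 ((c i.castSucc).1 - (c i.succ).1) ≤ 2}).ncard ≤ 3750 ^ k := by
  intro k p₀
  -- the box `[-2,2]⁴`, generalized to an opaque `B` (keeps `whnf` off its 625-element normal form)
  obtain ⟨B, hBmem, hBcard⟩ : ∃ B : Finset (Site 4),
      (∀ x : Site 4, siteSupNorm x ≤ 2 → x ∈ B) ∧ B.card = 625 :=
    ⟨_, fun _ hx => chainCount_mem_box hx, chainCount_card_box⟩
  set S : Set (Fin (k + 1) → ZdPlaquette 4) :=
    {c | c 0 = p₀ ∧ ∀ i : Fin k, siteSupNorm ((c i.castSucc).1 - (c i.succ).1) ≤ 2}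
  -- the step data of a chain
  set f : (Fin (k + 1) → ZdPlaquette 4) → Fin k → Site 4 × {p : Fin 4 × Fin 4 // p.1 < p.2} :=
    fun c i => ((c i.castSucc).1 - (c i.succ).1, (c i.succ).2) with hf
  set T : Finset (Fin k → Site 4 × {p : Fin 4 × Fin 4 // p.1 < p.2}) :=
    Fintype.piFinset fun _ : Fin k => B ×ˢ Finset.univ with hT
  -- the step data of an admissible chain lie in `T`
  have hmaps : Set.MapsTo f S ↑T := by
    intro c hc
    rw [Finset.mem_coe, hT, Fintype.mem_piFinset]
    intro i
    exact Finset.mk_mem_product (hBmem _ (hc.2 i)) (Finset.mem_univ _)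
  -- and determine the chain
  have hinj : Set.InjOn f S := by
    rw [hf]
    exact (chainCount_steps_injOn k p₀).mono fun c hc => hc.1
  -- `#T = (625 · 6) ^ k`
  have hTcard :
      (↑T : Set (Fin k → Site 4 × {p : Fin 4 × Fin 4 // p.1 < p.2})).ncard = 3750 ^ k := by
    rw [Set.ncard_coe_finset, hT, Fintype.card_piFinset, Finset.prod_const, Finset.card_univ,
      Fintype.card_fin, Finset.card_product, hBcard, chainCount_card_orient]
  refine ⟨Set.Finite.of_injOn hmaps hinj T.finite_toSet, ?_⟩
  calc S.ncard ≤ (↑T : Set (Fin k → Site 4 × {p : Fin 4 × Fin 4 // p.1 < p.2})).ncard :=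
        Set.ncard_le_ncard_of_injOn f hmaps hinj T.finite_toSet
    _ = 3750 ^ k := hTcard

end Summit.QuantumFields.YangMills.Theorems.NonSimplyConnectedLatticeGap

end
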